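import Summits.BirchSwinnertonDyer.BirchSwinnertonDyer.Theses.TangentCone
import Summits.BirchSwinnertonDyer.BirchSwinnertonDyer.Theorems.SqueezeUB.Negative.FalseWithoutIsElliptic
import Literature.NumberTheory.EllipticCurves.LeadingTerm
import Literature.NumberTheory.EllipticCurves.BSDSha
import Literature.NumberTheory.EllipticCurves.HeegnerPoints
import Literature.NumberTheory.EllipticCurves.NonvanishingTwists
import Literature.Barriers.BirchSwinnertonDyer.HeegnerPointsRankOneProofs
import HarnessLib

/-!
# Disproof of `RankLeOne` (stmt-BirchSwinnertonDyer-17610, route TangentCone) — findings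

Standing disprover (cdisprove), cycle 1, 2026-08-17. VERDICT: **no kill; the crux is a theorem in
print, typed faithfully.** Everything conclusive below is kernel-checked; prose lives in docstrings.

* §0 `rankLeOne_iff_fact` — the crux is `Iff.rfl`-equal to the Literature fact bsd.S17
  `Literature.NumberTheory.EllipticCurves.rank_eq_analyticRank_of_analyticRank_le_one`
  (Gross–Zagier 1986 Thm I.6.3 + Kolyvagin 1990 Thm A + modularity; Darmon 2004 Thm 3.22). A
  refutation `¬ RankLeOne` would refute Gross–Zagier–Kolyvagin for some explicit `E/ℚ`; the only
  conceivable escape is DEFINITIONAL JUNK, audited in §3 (none found).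
* §1 LOAD-BEARING ANALYSIS (the crux has exactly two hypotheses).
  - `[W.IsElliptic]` is load-bearing: `rankLeOne_false_without_isElliptic` (witness: the cuspidal
    cubic `y² = x³ = ⟨0,0,0,0,0⟩`, `analyticRank = 0` (L ≡ 1, every place additive) but
    `mordellWeilRank = finrank ℤ E_ns(ℚ) = finrank ℤ ℚ = 1`; the cusp computations are REUSED from
    the landed `Theorems/SqueezeUB/Negative/FalseWithoutIsElliptic.lean`, not re-proved).
    LANDED (p145344, commit 586fb57c1182) as `Theorems/RankLeOne/Negative/FalseWithoutIsElliptic.lean`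
    (`Theorems.rankLeOne_false_without_isElliptic`, `Theorems.rankLeOne_withoutBound_iff_summit_and_shaFinite`);
    the theorems of §1 below restate them inside this workfile (kept self-contained so that it
    elaborates independently of the farm's build of the new module).
  - `(h : W.analyticRank ≤ 1)` is load-bearing modulo open conjectures: dropping it gives EXACTLY
    the summit statement together with the Tate–Shafarevich conjecture over `ℚ`
    (`rankLeOneWithoutBound_iff`), so no cheap `¬` exists (it would refute BSD ∧ Ш-finiteness).
* §2 TIGHTNESS of the bound `1` for the picked line `gzk` (Heegner points): at `analyticRank ≥ 2`
  the Gross–Zagier input `L'(E/K,1)` vanishes UNCONDITIONALLY (`lDerivEK_eq_zero_at_two`, re-export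
  of the barrier theorem `LDerivEK_eq_zero_of_two_le_analyticRank_unconditional`), so the
  hypothesis `≤ 1` cannot be relaxed inside this mechanism (= `HeegnerPointBarrier(Narrow)`); this
  is a barrier for the LINE, not a defect of the crux, whose regime is disjoint (`barrier_disjoint`).
* §3 DEFINITIONAL-JUNK AUDIT (escape routes for a refutation; all closed):
  `analyticRank = analyticOrderNatAt entireLFunction 1` is the true order because
  `LFunction` (Mathlib, Euler product of local factors of MINIMAL models: `1 − aT + qT²` with
  `a = q+1−#Ẽ(𝔽_q)` counting `O`; `1 ∓ T` by the node tangent-cone splitting test; `1` additive) is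
  the Hasse–Weil L-function exactly, hence entire by modularity (true, if unformalised), so the junk
  branch (`entireLFunction := LSeries`) is never taken for elliptic `W`; `mordellWeilRank = finrank ℤ
  E(ℚ)` is the rank (Mordell–Weil proved in tree, `module_finite_point_holds`); `sha` = kernel of ALL
  local restrictions (finite AND infinite places) in continuous `H¹(Γ_ℚ, E(ℚ̄))` with discrete
  coefficients — genuine Ш; all three are isomorphism invariants, so quantifying over all models is
  harmless. Recorded here as the sanity theorems `cusp_shows_junk_is_real` (the junk IS reachable
  without `IsElliptic`, and only there).
* §4 NATURAL STRENGTHENINGS: `RankLeOneConverse` (rank ≤ 1 ⇒ BSD-rank ∧ Ш finite) — OPEN (only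
  p-converse theorems: Skinner 2020, W. Zhang 2014, Burungale–Skinner–Tian), not refutable;
  `RankLeOneShaTrivial` (Ш = 0 in analytic rank ≤ 1) — FALSE ON PAPER (Cremona 571a1: r_an = 0,
  #Ш = 4; 681b1: #Ш = 9) but NOT Lean-refutable today (near-miss `not_rankLeOneShaTrivial`, sorried,
  obstruction in its docstring); over number fields — open beyond the cases of Zhang 2001 / YZZ.
* §5 TARGETS = stubs of line `gzk` (M, Wa, MM, GZ, Ko; payload.targets empty this cycle): each is a
  Literature fact carrying its hypotheses INTERNALLY (`[W.IsElliptic]`, `IsImaginaryQuadratic K`,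
  `SatisfiesHeegnerHypothesis N K`, the datum `ModularParametrizationData W N`), so the outer
  `∀ N W K` of `stub_grossZagier` / `stub_kolyvagin` is harmless: vacuous at singular `W`
  (`gross_zagier_cusp`, `kolyvagin_cusp`) and, given Carayol's level fact, off the level `N ≠ N_W`
  (`kolyvagin_off_level`). MUTATION: (Wa), (MM) are consumed by the assembly only through their
  one-field corollaries `.exists` (`B = 0`), so their "infinitely many fields" strength is dead
  weight for the line (`WaldspurgerOneField`, `MurtyMurtyOneField`, reshape candidates).
  No stub is Lean-refutable; the one SOFT SPOT is definitional: (M), (Wa),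
  (MM) are typed with `W.conductorNorm ℤ` (Ogg's formula over the tree's Tate-algorithm
  `kodairaSymbolAt`) and `W.rootNumber` — a slip in Tate's algorithm at `p ∈ {2,3}` would make
  `exists_isNewformOf` FALSE as typed for the affected curves (no newform of the wrong level), with
  no Lean-visible symptom. Recommended cheap check for the lead / a ccert seat: certify
  `conductorNorm` on Cremona's `p ∈ {2,3}`-additive curves (e.g. 48a1, 27a1, 36a1, 54a1) against the
  tables, by unfolding `kodairaSymbolOfMinimal` on their minimal models.

Census: attacks tried — identity with bsd.S17; simp/decide/aesop n/a (fact undischarged); junk audit of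
the four definitions; hypothesis mutation (both binders); barrier catalogue (HeegnerPointsRankOne:
disjoint regime; PAdicHeight / ExceptionalZero: irrelevant to r_an ≤ 1 over ℂ); negatives index
(`ledger negatives`: TamePinch CM entry, unrelated); stub side-condition audit. Resists because: GZK.
-/

set_option linter.dupNamespace false

namespace Summit.BirchSwinnertonDyer.BirchSwinnertonDyer.Cruxes.RankLeOne.Disproof

open Summit.BirchSwinnertonDyer.BirchSwinnertonDyer.Theses.TangentCone (RankLeOne)
open Summit.BirchSwinnertonDyer.BirchSwinnertonDyer.Theorems
open Literature.NumberTheory.EllipticCurves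

/-! ## §0 The crux is the Literature fact bsd.S17, symbol for symbol -/

/-- `RankLeOne` IS `rank_eq_analyticRank_of_analyticRank_le_one` (Darmon 2004 Thm 3.22). [folklore] -/
theorem rankLeOne_iff_fact : RankLeOne ↔ rank_eq_analyticRank_of_analyticRank_le_one := Iff.rfl

/-! ## §1 Load-bearing hypotheses -/

/-- The crux with the instance binder `[W.IsElliptic]` DROPPED (all Weierstrass cubics over `ℚ`,
singular ones included). [folklore] -/
def RankLeOneWithoutIsElliptic : Prop :=
  ∀ (W : WeierstrassCurve ℚ), W.analyticRank ≤ 1 → W.mordellWeilRank = W.analyticRank ∧ Finite W.sha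

/-- **`[W.IsElliptic]` is load-bearing**: without it the statement is FALSE. Witness the cuspidal
cubic `y² = x³`: its Mathlib L-function is `1` (every place additive), so `analyticRank = 0 ≤ 1`,
while `E_ns(ℚ) ≅ (ℚ, +)` has `finrank ℤ = 1`, so `mordellWeilRank = 1 ≠ 0`
(cusp facts from `Theorems/SqueezeUB/Negative/FalseWithoutIsElliptic.lean`). Any proof of the crux
must use `Δ ≠ 0`. [folklore] -/
theorem rankLeOne_false_without_isElliptic : ¬ RankLeOneWithoutIsElliptic := by
  intro h
  have h1 := (h ⟨0, 0, 0, 0, 0⟩ (by rw [squeezeUB_cusp_analyticRank]; exact Nat.zero_le 1)).1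
  rw [squeezeUB_cusp_analyticRank, squeezeUB_cusp_mordellWeilRank] at h1
  exact one_ne_zero h1

/-- The crux with the bound `(h : W.analyticRank ≤ 1)` DROPPED. [folklore] -/
def RankLeOneWithoutBound : Prop :=
  ∀ (W : WeierstrassCurve ℚ) [W.IsElliptic], W.mordellWeilRank = W.analyticRank ∧ Finite W.sha

/-- **Dropping the bound gives exactly the summit ∧ the Tate–Shafarevich conjecture over `ℚ`**
(`_root_.BirchSwinnertonDyer = Literature.BSDRankConjecture` and
`Literature.NumberTheory.EllipticCurves.ShaFiniteConjecture`). So `h` is load-bearing modulo two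
open conjectures, and no `¬ RankLeOneWithoutBound` can be landed short of refuting BSD. [folklore] -/
theorem rankLeOneWithoutBound_iff :
    RankLeOneWithoutBound ↔ (_root_.BirchSwinnertonDyer ∧ ShaFiniteConjecture) := by
  constructor
  · intro h
    exact ⟨fun W hW => ((@h W hW).1).symm, fun W hW => (@h W hW).2⟩
  · rintro ⟨hB, hS⟩ W hW
    exact ⟨(hB W hW).symm, hS W hW⟩

/-! ## §2 Tightness of the bound for the picked line `gzk` (Heegner points) -/

/-- **At analytic rank `≥ 2` the Gross–Zagier–Kolyvagin input dies, unconditionally**: for EVERY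
number field `K`, `L'(E/K, 1) := (L(E,s)·L(E^{(d_K)},s))'(1) = 0` as soon as `ord_{s=1} L(E,s) ≥ 2`
(re-export of the barrier theorem `LDerivEK_eq_zero_of_two_le_analyticRank_unconditional`,
Ireland–Rosen Prop. 20.5.4(b)). Hence the hypothesis `≤ 1` of the crux is exactly the regime of the
mechanism of line `gzk`; relaxing it to `≤ 2` leaves the line without its non-torsion Heegner point
(`HeegnerPointBarrierNarrow_holds`). A barrier for the LINE, not a defect of the crux. [folklore] -/
theorem lDerivEK_eq_zero_at_two (W : WeierstrassCurve ℚ) (K : Type) [Field K] [NumberField K]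
    (hr : 2 ≤ W.analyticRank) : LDerivEK W K = 0 :=
  Literature.Barriers.BirchSwinnertonDyer.LDerivEK_eq_zero_of_two_le_analyticRank_unconditional W K hr

/-- The crux's regime and the barrier's regime are disjoint (no curve has `r_an ≤ 1 ∧ 2 ≤ r_an`). [folklore] -/
theorem barrier_disjoint (W : WeierstrassCurve ℚ) : ¬ (W.analyticRank ≤ 1 ∧ 2 ≤ W.analyticRank) := by
  omega

/-! ## §3 The junk branches are real — but only without `IsElliptic` -/

/-- Sanity: the definitional junk the audit worried about IS reachable, at the singular witness:
`analyticRank (y² = x³) = 0` although its "Mordell–Weil rank" is `1`, and the witness is not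
elliptic — so the junk never meets the crux's domain. [folklore] -/
theorem cusp_shows_junk_is_real :
    (⟨0, 0, 0, 0, 0⟩ : WeierstrassCurve ℚ).analyticRank = 0 ∧
      (⟨0, 0, 0, 0, 0⟩ : WeierstrassCurve ℚ).mordellWeilRank = 1 ∧
      ¬ (⟨0, 0, 0, 0, 0⟩ : WeierstrassCurve ℚ).IsElliptic :=
  ⟨squeezeUB_cusp_analyticRank, squeezeUB_cusp_mordellWeilRank, squeezeUB_not_isElliptic_cusp⟩

/-! ## §4 Natural strengthenings (status record; nothing here is asserted) -/

/-- STRENGTHENING 1 — the converse slice "algebraic rank ≤ 1 ⇒ BSD-rank ∧ Ш finite". OPEN in print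
(known: p-converse theorems under extra hypotheses — Skinner 2020 Thm A, W. Zhang 2014,
Burungale–Skinner–Tian; no unconditional statement). Not refutable, not provable here. [folklore] -/
def RankLeOneConverse : Prop :=
  ∀ (W : WeierstrassCurve ℚ) [W.IsElliptic], W.mordellWeilRank ≤ 1 →
    W.mordellWeilRank = W.analyticRank ∧ Finite W.sha

/-- STRENGTHENING 2 — conclusion sharpened from `Finite Ш` to `Ш = 0`. FALSE ON PAPER: Cremona's
tables list `571a1` (`r_an = 0`, analytic `#Ш = 4`) and `681b1` (`#Ш = 9`); `66b3`/`1058d1` etc.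
But no element of `W.sha` (continuous `H¹`) is constructible in the tree today, so this is a
near-miss, see `not_rankLeOneShaTrivial`. [folklore] -/
def RankLeOneShaTrivial : Prop :=
  ∀ (W : WeierstrassCurve ℚ) [W.IsElliptic], W.analyticRank ≤ 1 →
    W.mordellWeilRank = W.analyticRank ∧ Subsingleton W.sha

/-- NEAR-MISS (sorried; workfile only). Obstruction: a proof needs (i) a curve with `r_an ≤ 1`
CERTIFIED in Lean — impossible before `hasEntireLFunction_rat` (modularity) is discharged, since
`analyticRank` is only pinned through the entire continuation — and (ii) a non-zero class in
`W.sha ⊆ H¹_cont(Γ_ℚ, E(ℚ̄))`, i.e. a 2-descent + Cassels–Tate computation on `571a1` inside the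
tree's cohomological `sha`; neither exists. Tried: nothing cheaper applies (Ш is not decidable data). [folklore] -/
theorem not_rankLeOneShaTrivial : ¬ RankLeOneShaTrivial := by
  sorry

/-! ## §5 Targets: the stubs of line `gzk` carry their hypotheses internally -/

/-- The outer `∀ W` of `stub_grossZagier` is harmless at singular `W`: `gross_zagier N W K` is
vacuous there (its first binder is `[W.IsElliptic]`). [folklore] -/
theorem gross_zagier_cusp (N : ℕ) [NeZero N] (K : Type) [Field K] [NumberField K] :
    gross_zagier N (⟨0, 0, 0, 0, 0⟩ : WeierstrassCurve ℚ) K := by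
  intro hE _ _
  exact absurd hE squeezeUB_not_isElliptic_cusp

/-- Same for `stub_kolyvagin`. [folklore] -/
theorem kolyvagin_cusp (N : ℕ) [NeZero N] (K : Type) [Field K] [NumberField K] :
    kolyvagin N (⟨0, 0, 0, 0, 0⟩ : WeierstrassCurve ℚ) K := by
  intro hE _ _ _ _ _
  exact absurd hE squeezeUB_not_isElliptic_cusp

/-- The outer `∀ N` of `stub_kolyvagin` is harmless off the conductor, GIVEN Carayol's level fact
`IsNewformOf.level_eq_conductorNorm` (a Literature fact, hypothesis `hlev`): a Heegner point of
level `N` presupposes a `ModularParametrizationData W N`, which forces `N = N_W`. [folklore] -/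
theorem kolyvagin_off_level (N : ℕ) [NeZero N] (W : WeierstrassCurve ℚ) (K : Type) [Field K]
    [NumberField K] (hlev : ModularForms.IsNewformOf.level_eq_conductorNorm (N := N))
    (hN : N ≠ W.conductorNorm ℤ) : kolyvagin N W K := by
  intro hE _ _ P hP _
  obtain ⟨Dt, -, -, -⟩ := hP
  exact absurd (Dt.level_eq_conductorNorm_holds hlev) hN

/-! ### Mutation finding for the lead: stubs (Wa), (MM) are stronger than the line consumes -/

/-- ONE Heegner field with `L(E^{(d_K)}, 1) ≠ 0` (the `B = 0` instance of `stub_waldspurger`). The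
tree's assembly behind `RankLeOne_of` (`exists_heegnerField_analyticRankEK_eq_one_of`,
`LeadingTermProofs`) uses (Wa) ONLY through `waldspurger_exists_heegnerField_twist_ne_zero.exists`,
i.e. through this statement; the "`∀ B, B < |d_K|`" (infinitely many fields) strength is dead
weight for line `gzk`. Reshape candidate if (Wa) stalls (Waldspurger 1985 Thm 5 gives this form
directly for a prescribed finite set of split primes). [folklore] -/
def WaldspurgerOneField : Prop :=
  ∀ (W : WeierstrassCurve ℚ) [W.IsElliptic], W.rootNumber = -1 →
    ∃ (K : Type) (_ : Field K) (_ : NumberField K),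
      IsImaginaryQuadratic K ∧ SatisfiesHeegnerHypothesis (W.conductorNorm ℤ) K ∧
        (W.quadraticTwist (NumberField.discr K : ℚ)).entireLFunction 1 ≠ 0

/-- ONE Heegner field with a simple zero of `L(E^{(d_K)}, s)` at `1` (the `B = 0` instance of
`stub_murtyMurty`); (MM) is consumed only through `.exists` likewise. [folklore] -/
def MurtyMurtyOneField : Prop :=
  ∀ (W : WeierstrassCurve ℚ) [W.IsElliptic], W.entireLFunction 1 ≠ 0 →
    ∃ (K : Type) (_ : Field K) (_ : NumberField K),
      IsImaginaryQuadratic K ∧ SatisfiesHeegnerHypothesis (W.conductorNorm ℤ) K ∧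
        (W.quadraticTwist (NumberField.discr K : ℚ)).entireLFunction 1 = 0 ∧
          deriv (W.quadraticTwist (NumberField.discr K : ℚ)).entireLFunction 1 ≠ 0

/-- (Wa) ⇒ its one-field form (so the reshape is a genuine weakening of the stub). [folklore] -/
theorem waldspurgerOneField_of (h : waldspurger_exists_heegnerField_twist_ne_zero) :
    WaldspurgerOneField :=
  fun W _ hw => h.exists W hw

/-- (MM) ⇒ its one-field form. [folklore] -/
theorem murtyMurtyOneField_of (h : murtyMurty_exists_heegnerField_twist_simpleZero) :
    MurtyMurtyOneField :=
  fun W _ hL => h.exists W hL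

end Summit.BirchSwinnertonDyer.BirchSwinnertonDyer.Cruxes.RankLeOne.Disproof
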